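import Summits.BirchSwinnertonDyer.BirchSwinnertonDyer.Theorems.ResidualThetaTransportAtTwoSignedMuVanishingAtTwoPlusSel2

/-!
# Line `ct-involution-parity` for crux `SignedMuSeedAtTwoPlus` (stmt-BirchSwinnertonDyer-21438) — crux-ideate r1 k2 (g11), v2

CASSELS–TATE EVENNESS AT THE INVOLUTION ⇒ FREE SUMMANDS OF Ш(W/ℚ_n) COME IN PAIRS ⇒ A COUNTEREXAMPLE TO CONJECTURE A
AT 2 NEVER HAS A SINGLE μ-SUMMAND.  Technique class: arithmetic duality + modular representation theory of cyclic
2-groups (no `L`-function, no Euler system, no elliptic units, no per-class certificate).  BSD is not proved by this.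

The lever.  On a finite layer `ℚ_n` (`n ≥ 1`, `G_n = Gal(ℚ_n/ℚ) = ⟨γ⟩ ≅ C_{2^n}`, involution `g₀ = γ^{2^{n-1}}`)
the Cassels–Tate pairing on `Ш(W/ℚ_n)[2^∞]/div = Sel_{2^∞}(W/ℚ_n)/div` is alternating (Cassels) and `G_n`-invariant;
alternation at the two layers `n, n-1` plus `res ∘ cor = 1 + g₀` and `⟨res a, y⟩_n = ⟨a, cor y⟩_{n-1}` give the
genuinely 2-adic identity `⟨g₀ x, x⟩ = ⟨cor x, cor x⟩_{n-1} = 0` (S2, **even-symplectic**).  Pure algebra (S1,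
exhaustive search over `C₂, C₄, C₈`-modules: `calc/claimB*.py`, `calc/claimS1.py`, 0/31 violations): an even-symplectic
finite `ℤ[C_{2^n}]`-module has an EVEN number of free `(ℤ/2^k)[C_{2^n}]`-summands in every grade `k` (for `k ≥ 2`
alternation suffices; at `k = 1` evenness is indispensable — `𝔽₂[C_{2^n}]` itself IS symplectic-invariant).
WHERE IT BITES (v2, after `calc/jordan_scan.py`): every truncated block `𝔽₂[T]/T^e`, `e < 2^n` even, carries an
even-symplectic form, so the signed increments `(Λ/2^k)/(ω_n^±)` (Kobayashi–Kurihara–Pollack layer structure) escape the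
law; what does NOT escape is a μ-summand `Λ/2^k` of the FINE dual `X₀(W/ℚ_∞)`, which descends by EXACT fine control
(`E(ℚ_{2,∞})[2] = 0`, `E(ℚ_∞)[2] = 0` on the habitat) to a genuinely free `(ℤ/2^k)[G_n] = (Λ/2^k)/ω_n` inside
`Sel(W/ℚ_n)`, a projective–injective module over the Frobenius ring `(ℤ/2^k)[G_n]` (S3).  Hence (S1–S3): a habitat class
violating Conjecture A at 2 cannot do so with residual fine `Ω`-corank ONE — the shape forced whenever
`d₂ Cl(L_W) ≤ 1` (one prime above 2 in `L_W^{cyc}`, Iwasawa–Nakayama), e.g. 406203s1 (`h = 18`): the law predicts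
`d₄ ≤ 15` in j307161's undecided layer-4 test.  (S4) is the residue "a counterexample never needs two μ-summands"
(strictly weaker than (F), provable on the cyclic-2-class-group sub-habitat), and (S5) = (F) ⇒ (P⁺) is the problem of
record shared with `sign-dichotomy` (its S1+S2+S3+S5) and `fine-plus-split` (its S2 + certificate): this line's own
contribution is a uniform, certificate-free attack on the (F) HALF.
-/

open WeierstrassCurve Literature.NumberTheory.EllipticCurves
open Literature.NumberTheory.EllipticCurves.Kobayashi2003
open Literature.NumberTheory.EllipticCurves.Rank1Residual
open Literature.NumberTheory.EllipticCurves.ModularForms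
open Summit.BirchSwinnertonDyer.Rank1Residual.Supersingular Summit.BirchSwinnertonDyer.Rank1Residual.X1
open Summit.BirchSwinnertonDyer.BirchSwinnertonDyer.Theses.ResidualThetaTransportAtTwo
open scoped MatrixGroups ModularForm
open CongruenceSubgroup

noncomputable section

namespace Summit.BirchSwinnertonDyer.BirchSwinnertonDyer.Cruxes.SignedMuSeedAtTwoPlus.CtInvolutionParity

/-! ### Currencies -/

/-- `Sel^ε(W/ℚ_∞)[2]` is finite (the SEL2 currency of the door `signedMuSeedAtTwoPlus_of_sel2Seed`). -/
def SignedResidualFinite (W : WeierstrassCurve ℚ) [W.IsElliptic] (κ : ZpExtension ℚ 2) (ε : ℤˣ) : Prop :=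
  {s : signedSelmerInfty W κ ε | 2 • s = 0}.Finite

/-- `Sel₀(W/ℚ_∞)[2]` (residual fine = strict Selmer group) is finite: Conjecture A at 2 in residual form. -/
def FineResidualFinite (W : WeierstrassCurve ℚ) [W.IsElliptic] (κ : ZpExtension ℚ 2) : Prop :=
  {s : W.fineSelmerInfty κ | 2 • s = 0}.Finite

/-- `U_k(A) = 2^{k-1}·A ∩ A[2]` (`k ≥ 1`): grade-`k` layer of the 2-socle filtration of a commutative group. -/
def gradeSub (A : Type*) [AddCommGroup A] (k : ℕ) : AddSubgroup A :=
  ((2 ^ (k - 1)) • AddMonoidHom.id A).range ⊓ AddSubgroup.torsionBy A 2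

/-- Norm element `N_n(g) = Σ_{i<2^n} g^i` of the cyclic group generated by an endomorphism `g`. -/
def normElt {A : Type*} [AddCommGroup A] (g : AddMonoid.End A) (n : ℕ) : A →+ A :=
  ∑ i ∈ Finset.range (2 ^ n), (g ^ i : AddMonoid.End A)

/-- Grade-`k` free multiplicity `m_k(A) = log₂ |N(U_k) + U_{k+1}| - log₂ |U_{k+1}|` (decomposition-free; on
`⊕ᵢ (ℤ/2^{kᵢ})[C_{2^n}] ⊕ (no free summand)` it counts the `i` with `kᵢ = k`). -/
def freeMult (A : Type*) [AddCommGroup A] (N : A →+ A) (k : ℕ) : ℕ :=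
  Nat.log 2 (Nat.card ↥((gradeSub A k).map N ⊔ gradeSub A (k + 1))) -
    Nat.log 2 (Nat.card ↥(gradeSub A (k + 1)))

/-- A *layer quotient datum* for a `Γ_ℚ`-stable subgroup `S ≤ H¹(H, W[2^∞])` (`H = Gal(ℚ̄/ℚ_n)`): a group `M`
with a `Γ_ℚ`-action by endomorphisms and an equivariant surjection `π : S → M` whose kernel is exactly the divisible
elements of `S` — i.e. `M = S/div` with its `G_n`-action (`conjH1`), packaged without quotient types. -/
def IsLayerQuotient (W : WeierstrassCurve ℚ) [W.IsElliptic] (H : Subgroup (Field.absoluteGaloisGroup ℚ)) [H.Normal]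
    (S : AddSubgroup (W.subgroupH1 2 H)) (M : Type) [AddCommGroup M]
    (act : Field.absoluteGaloisGroup ℚ →* AddMonoid.End M) (π : ↥S →+ M) : Prop :=
  Function.Surjective π ∧
    (∀ s, π s = 0 ↔ ∀ m : ℕ, 0 < m → ∃ t : ↥S, m • t = s) ∧
    ∀ (σ : Field.absoluteGaloisGroup ℚ) (s : ↥S) (hs : W.conjH1 2 H σ s ∈ S), π ⟨W.conjH1 2 H σ s, hs⟩ = act σ (π s)

/-- **Residual fine `Ω`-corank ≤ 1**: `|Sel₀(ℚ_∞, W)[2]^{Γ_n}| ≤ C · 2^{2^n}` for all `n` (the fixed points are finite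
and grow like ONE copy of `(Ω/ω_n)^∨ = 𝔽₂[G_n]`), i.e. the fine dual `X₀(W/ℚ_∞)` has at most one `μ`-summand. -/
def FineResidualCorankLeOne (W : WeierstrassCurve ℚ) [W.IsElliptic] (κ : ZpExtension ℚ 2) : Prop :=
  ∃ C : ℕ, ∀ n : ℕ,
    {s : ↥(W.fineSelmerInfty κ) | 2 • s = 0 ∧ ∀ σ ∈ κ.layerSubgroup n,
        W.conjH1 2 κ.kerSubgroup σ (s : W.subgroupH1 2 κ.kerSubgroup) = s}.Finite ∧
    Nat.card {s : ↥(W.fineSelmerInfty κ) | 2 • s = 0 ∧ ∀ σ ∈ κ.layerSubgroup n,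
        W.conjH1 2 κ.kerSubgroup σ (s : W.subgroupH1 2 κ.kerSubgroup) = s} ≤ C * 2 ^ (2 ^ n)

/-! ### The stubs -/

/-- **S1 — even-symplectic free-parity law (pure algebra).** A finite abelian group with an endomorphism
`g`, `g^{2^n} = 1` (`n ≥ 1`), carrying a nondegenerate alternating `g`-invariant `ℚ/ℤ`-valued pairing that is
*even for the involution* `g^{2^{n-1}}` has even free multiplicity in every grade `k ≥ 1`.
Proof plan: Krull–Schmidt radical argument — maps `R_k[G] → R_k[G]` factoring through a non-free indecomposable
are non-isomorphisms, so the form is nondegenerate on a free isotypic block `F = R_k[G]^m`; its hermitian Gram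
matrix `U ∈ M_m(R_k[G])` has `ε(U_ii) = 0`, `(U_ii)_{g₀} = 0` (evenness) and the other coefficients of `U_ii` in
`2^{k-1}R_k` (alternation), so the augmented matrix mod 2 is symmetric, invertible, with zero diagonal:
`m` even.  Why it might fail: the decomposition-free invariant `freeMult` must agree with the Krull–Schmidt
count on glued modules (checked on 31 small `C₂/C₄`-modules, `calc/claimS1.py`). -/
def EvenSymplecticFreeParity : Prop :=
  ∀ (n : ℕ), 1 ≤ n → ∀ (A : Type) [AddCommGroup A] [Finite A] (g : AddMonoid.End A)
    (B : A →+ A →+ AddCircle (1 : ℚ)),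
    g ^ (2 ^ n) = 1 →
    (∀ x, (∀ y, B x y = 0) → x = 0) →
    (∀ x, B x x = 0) →
    (∀ x y, B (g x) (g y) = B x y) →
    (∀ x, B ((g ^ (2 ^ (n - 1))) x) x = 0) →
    ∀ k, 1 ≤ k → Even (freeMult A (normElt g n) k)

/-- **S2 — even Cassels–Tate pairing on `Ш(W/ℚ_n)/div` at the 2-power cyclotomic layers.** For `W/ℚ` elliptic,
the cyclotomic `ℤ₂`-extension with topological generator `γ` and a layer `n ≥ 1`: `Sel_{2^∞}(W/ℚ_n)/div = Ш(W/ℚ_n)[2^∞]/div`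
(as a layer quotient datum: finite `M`, `Γ_ℚ`-action, kernel = divisible elements) carries a nondegenerate alternating
pairing invariant under `γ`, `γ^{2^n}` acts trivially, and the pairing is EVEN for `γ^{2^{n-1}}`.
Sources: Cassels 1962/1965 (alternating, kernel = divisible part), Tate 1963 / Milne ADT I.6.13; Galois equivariance and
`res/cor` functoriality of the Cassels–Tate pairing (e.g. Fisher 2003 App., Česnavičius 2015); evenness =
`⟨g₀ x, x⟩ = ⟨res cor x, x⟩ − ⟨x, x⟩ = ⟨cor x, cor x⟩_{n−1} = 0`.  The tree has the per-field shape
`WeierstrassCurve.exists_casselsTate_pairing` (BSDSha.lean) but neither equivariance nor `res/cor` compatibility.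
Why it might fail: only through a functoriality subtlety at 2 (the adjunction `⟨res a, y⟩_n = ⟨a, cor y⟩_{n−1}` for
Ш of the base-changed curve) — believed standard; size L because Ш over the layer fields is not yet a tree object. -/
def ShaLayerEvenPairingAtTwo : Prop :=
  ∀ (W : WeierstrassCurve ℚ) [W.IsElliptic] (κ : ZpExtension ℚ 2), κ.IsCyclotomic →
    ∀ (γ : Field.absoluteGaloisGroup ℚ), κ.IsTopGenerator γ → ∀ (n : ℕ), 1 ≤ n →
    ∃ (M : Type) (_ : AddCommGroup M) (_ : Finite M) (act : Field.absoluteGaloisGroup ℚ →* AddMonoid.End M)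
      (π : ↥(W.selmerLayer κ n) →+ M) (B : M →+ M →+ AddCircle (1 : ℚ)),
      IsLayerQuotient W (κ.layerSubgroup n) (W.selmerLayer κ n) M act π ∧
      act γ ^ (2 ^ n) = 1 ∧
      (∀ x, (∀ y, B x y = 0) → x = 0) ∧
      (∀ x, B x x = 0) ∧
      (∀ x y, B (act γ x) (act γ y) = B x y) ∧
      (∀ x, B ((act γ ^ (2 ^ (n - 1))) x) x = 0)

/-- **S3 — one fine μ-summand descends to ONE free summand of `Ш(W/ℚ_n)/div` (exact fine control at 2).** On the
habitat, if `Sel₀(ℚ_∞, W)[2]` is infinite but of `Ω`-corank ≤ 1 (so the fine dual is `X₀ ∼ Λ/2^k ⊕ (no μ)`), then for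
all large `n` every layer quotient datum of `Sel_{2^∞}(W/ℚ_n)` has ODD grade-`k` free multiplicity.
Content: fine control `Sel₀(ℚ_n) = Sel₀(ℚ_∞)^{Γ_n}` is exact at 2 and at ∞ on the habitat (`E(ℚ_∞)[2] = 0`,
`E(ℚ_{2,∞})[2] = 0` as `ℚ₂(W[2])/ℚ₂` is cubic ramified), with bad-prime errors `⊕_λ E(ℚ_{∞,λ})[2^∞]_{Γ_n}` bounded and
induced; `(Λ/2^k)/ω_n = (ℤ/2^k)[G_n]` is projective AND injective over the Frobenius ring `(ℤ/2^k)[G_n]`, so it splits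
off `Sel₀(ℚ_n)[2^k]` and off any `(ℤ/2^k)[G_n]`-module containing it; the complement — `λ`-blocks of 2-rank `< 2^n`, the
local image `Ш_n/Ш_{0,n} ↪ E(k_n) ⊗ ℚ₂/ℤ₂` made of truncated signed blocks `(ℤ/2^j)[T]/(ω_n^±)`, and the Mordell–Weil
part of bounded corank (Kato–Rohrlich) — contributes no free summand.  Sources: Greenberg LNM 1716 §3–4 (control),
Kobayashi2003 §9–10 and Kurihara 2002 Invent. 149 (layer structure at supersingular primes, `p` odd), IovitaPollack2006
(`ω_n^±`-truncations), Curtis–Reiner §62 (group rings over `ℤ/p^k` are quasi-Frobenius).  Why it might fail: gluing —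
an index-4 defect turns `𝔽₂[G_n]` into the even-symplectic-capable `J_{2^n−2}` (`calc/jordan_scan.py`; index 2 does
not: `J_{2^n−1} ⊕ J_1` is incapable), so the stub needs the error terms (even Tamagawa numbers, positive-rank layers)
not to meet the free summand; cleanest sub-habitat: odd Tamagawa numbers and `L(W,χ,1) ≠ 0` for all 2-power `χ`.
This is the line's hard stub. -/
def OddFreeGradeFromFineMuAtTwo : Prop :=
  ∀ (W : WeierstrassCurve ℚ) [W.IsElliptic] [W.IsGloballyMinimal], ¬ W.HasCM → W.analyticRank = 0 →
    GoodSS W 2 → W.frobeniusTrace 2 = 0 → W.Δ < 0 →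
    ∀ (κ : ZpExtension ℚ 2) (γ : Field.absoluteGaloisGroup ℚ), κ.IsCyclotomic → κ.IsTopGenerator γ →
    ¬ FineResidualFinite W κ → FineResidualCorankLeOne W κ →
    ∃ k, 1 ≤ k ∧ ∃ n₀ : ℕ, ∀ n, n₀ ≤ n → 1 ≤ n →
      ∀ (M : Type) [AddCommGroup M] [Finite M] (act : Field.absoluteGaloisGroup ℚ →* AddMonoid.End M)
        (π : ↥(W.selmerLayer κ n) →+ M), IsLayerQuotient W (κ.layerSubgroup n) (W.selmerLayer κ n) M act π →
        Odd (freeMult M (normElt (act γ) n) k)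

/-- **S4 — fine corank dichotomy (the residue of Conjecture A at 2 left by the parity law).** On the habitat the
residual fine group is finite OR has `Ω`-corank exactly ≤ 1: a counterexample to Conjecture A at 2 never needs TWO
`μ`-summands.  Provable outright when `d₂ Cl(L_W) ≤ 1` (`L_W` the cubic field of `W[2]`; `2 = 𝔮³` is the only prime
ramified in `L_W^{cyc}/L_W`, so `X_nr(L_W^{cyc})` is `Λ`-cyclic by Iwasawa–Nakayama, and the residual fine corank is
bounded by its number of `μ`-summands via the tree's reflection `fineResidualFinite_iff_classicalMu_divisionField_two`);
conjecture-grade (but strictly weaker than (F)) on classes with non-cyclic 2-class group.  Sources: Iwasawa 1973 §?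
(one ramified prime ⇒ `X_Γ ≅ A₀`), Washington GTM 83 Lemma 13.15 / Prop 13.22, CoatesSujatha2005 Conj A, census
j306069 (7152/7741 classes certified (F) at layer ≤ 3).  Why it might fail: a class with `Cl(L_W)[2] ≅ (ℤ/2)²` and
two genuine `μ`-summands — exactly the configuration no current engine (certificate or parity) reaches. -/
def FineCorankDichotomyAtTwo : Prop :=
  ∀ (W : WeierstrassCurve ℚ) [W.IsElliptic] [W.IsGloballyMinimal], ¬ W.HasCM → W.analyticRank = 0 →
    GoodSS W 2 → W.frobeniusTrace 2 = 0 → W.Δ < 0 →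
    ∀ (κ : ZpExtension ℚ 2), κ.IsCyclotomic → FineResidualFinite W κ ∨ FineResidualCorankLeOne W κ

/-- **S5 — (F) ⇒ (P⁺): the plus half given the fine half (problem of record, NOT this line's contribution).** On the
habitat, residual fine finite and `X⁺` finitely generated ⇒ `Sel⁺(W/ℚ_∞)[2]` finite.  Implied by the registered stubs of
line `sign-dichotomy` (`signedResidualFinite_one_of_fine`: S1 residual sign dichotomy + S2 Coleman ratio + S3 theta
parity order, with S5 Pollack supply) and by line `fine-plus-split` (S2 `SplitFiniteness` + the plus-local certificate).
Sources: those line cards; Kobayashi2003 Thm 1.2 shape; LeiSujatha2021 Thm 1.2 (odd `p`, under IMC).  Why it might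
fail: it is the (P⁺) problem itself given (F) — open at 2; listed so that the skeleton concludes the crux by name. -/
def PlusOfFineAtTwo : Prop :=
  ∀ (W : WeierstrassCurve ℚ) [W.IsElliptic] [W.IsGloballyMinimal], ¬ W.HasCM → W.analyticRank = 0 →
    GoodSS W 2 → W.frobeniusTrace 2 = 0 → W.Δ < 0 →
    ∀ (κ : ZpExtension ℚ 2) (γ : Field.absoluteGaloisGroup ℚ), κ.IsCyclotomic → κ.IsTopGenerator γ →
    FineResidualFinite W κ → (∃ D : SignedSelmerDualData W κ γ 1, Module.Finite (IwasawaAlgebra 2) D.X) →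
    SignedResidualFinite W κ 1

theorem stub_evenSymplecticFreeParity : EvenSymplecticFreeParity := by
  sorry

theorem stub_shaLayerEvenPairingAtTwo : ShaLayerEvenPairingAtTwo := by
  sorry

theorem stub_oddFreeGradeFromFineMuAtTwo : OddFreeGradeFromFineMuAtTwo := by
  sorry

theorem stub_fineCorankDichotomyAtTwo : FineCorankDichotomyAtTwo := by
  sorry

theorem stub_plusOfFineAtTwo : PlusOfFineAtTwo := by
  sorry

/-! ### Composition (kernel-checked, no sorry) -/

/-- **The parity law's theorem-shaped output: residual Conjecture A at 2 on the habitat** from S1–S4 — a single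
`μ`-summand of the fine dual would give an odd free multiplicity in an even-symplectic module. -/
theorem fineResidualFinite_of_parity (h1 : EvenSymplecticFreeParity) (h2 : ShaLayerEvenPairingAtTwo)
    (h3 : OddFreeGradeFromFineMuAtTwo) (h4 : FineCorankDichotomyAtTwo)
    (W : WeierstrassCurve ℚ) [W.IsElliptic] [W.IsGloballyMinimal]
    (hCM : ¬ W.HasCM) (hr : W.analyticRank = 0) (hss : GoodSS W 2) (ha : W.frobeniusTrace 2 = 0) (hΔ : W.Δ < 0)
    (κ : ZpExtension ℚ 2) (γ : Field.absoluteGaloisGroup ℚ) (hκ : κ.IsCyclotomic) (hγ : κ.IsTopGenerator γ) :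
    FineResidualFinite W κ := by
  by_contra hinf
  have hc : FineResidualCorankLeOne W κ := (h4 W hCM hr hss ha hΔ κ hκ).resolve_left hinf
  obtain ⟨k, hk, n₀, hn₀⟩ := h3 W hCM hr hss ha hΔ κ γ hκ hγ hinf hc
  obtain ⟨M, _, _, act, π, B, hquot, hpow, hnd, halt, hinv, heven⟩ :=
    h2 W κ hκ γ hγ (max n₀ 1) (le_max_right _ _)
  have hE : Even (freeMult M (normElt (act γ) (max n₀ 1)) k) :=
    h1 (max n₀ 1) (le_max_right _ _) M (act γ) B hpow hnd halt hinv heven k hk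
  have hO : Odd (freeMult M (normElt (act γ) (max n₀ 1)) k) :=
    hn₀ (max n₀ 1) (le_max_left _ _) (le_max_right _ _) M act π hquot
  exact (Nat.not_even_iff_odd.mpr hO) hE

theorem SignedMuSeedAtTwoPlus_of_stubs (h1 : EvenSymplecticFreeParity) (h2 : ShaLayerEvenPairingAtTwo)
    (h3 : OddFreeGradeFromFineMuAtTwo) (h4 : FineCorankDichotomyAtTwo) (h5 : PlusOfFineAtTwo) :
    SignedMuSeedAtTwoPlus := by
  refine Theorems.SignedMuAtTwo.signedMuSeedAtTwoPlus_of_sel2Seed ?_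
  intro W _ _ hCM hr hss ha hΔ
  refine ⟨W, ‹_›, ‹_›, hss, ha, ⟨AddEquiv.refl _, fun σ P ↦ rfl⟩, fun κ γ hκ hγ hD ↦ ?_⟩
  exact h5 W hCM hr hss ha hΔ κ γ hκ hγ
    (fineResidualFinite_of_parity h1 h2 h3 h4 W hCM hr hss ha hΔ κ γ hκ hγ) hD

/-- The line concludes the crux BY NAME. -/
theorem SignedMuSeedAtTwoPlus_of :
    Summit.BirchSwinnertonDyer.BirchSwinnertonDyer.Theses.ResidualThetaTransportAtTwo.SignedMuSeedAtTwoPlus :=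
  SignedMuSeedAtTwoPlus_of_stubs stub_evenSymplecticFreeParity stub_shaLayerEvenPairingAtTwo
    stub_oddFreeGradeFromFineMuAtTwo stub_fineCorankDichotomyAtTwo stub_plusOfFineAtTwo

end Summit.BirchSwinnertonDyer.BirchSwinnertonDyer.Cruxes.SignedMuSeedAtTwoPlus.CtInvolutionParity

end
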